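/-
Copyright (c) 2026 the pub-hodgecm-mathlib formalisation cell (harness21).  Prover seat hodgecm-mathlib-R90-CS-p03 (g4), Track B ∕ R90-TF, h413 = `stmt-HodgeConjecture-24833`,
R90-TF section S8 «ContSpec-n½» (S8 dealer R90-CS-plan (g3) S8-R251 (valve) «hW1_wild SHRUNK TO A NAMED REGULARITY» + chair K2-lead (g2) VALVE 32 (mm) branch 1; census
`R90/S8/CENSUS-hW1wild-LocallyBounded.R90-CS-p03-g4.md` 97780511196f0256): continuity in `g` of THE continued Eisenstein family `Ec z g` of a D1 datum is AUTOMATIC from ESTATE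
T's joint local bound — so the regular data of ★ p865108 are the LOCALLY BOUNDED data and hW1_wild dies to local boundedness in `g` only.
-/
import Summits.HodgeConjecture.HodgeConjecture.Theorems.R90S8ResGMidBlockLeTauOfRegularU3        -- ★ p865108 (this seat): `hW1_of_regular (hFIN) (hKwild) (hKreg)`; brings ★ p865018, ★ D1–D3, ★ τ-DEFS
import Summits.HodgeConjecture.HodgeConjecture.Theorems.R90S8ResGMidAtomGenKTypeProjectionU3    -- ★ p865022 (LH4-p10 (g9)): `admissible_rightAverage` (its `hE4`∕`hEbd` bytes); brings ★ `exists_uniform_bound_of_locally_bounded` (CT-RES),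
                                                                                                 --   ★ `exists_bound_of_mem_chiSectionSpacePair_midBlock` (tube seed), Mathlib circle integrals
import Summits.HodgeConjecture.HodgeConjecture.Theorems.K2E1BorelEisensteinRegularCMThree        -- ★ `continuous_eisensteinSeriesU_flatSectionU_cm_three` (`g ↦ E(flat(φ, z))(g)` continuous on `{2 < Re z}`)
import Mathlib.Analysis.Complex.CauchyIntegral                                                   -- Mathlib `DifferentiableOn.hasFPowerSeriesOnBall`, `cauchyPowerSeries_apply`
import Mathlib.Analysis.Convex.PathConnected                                                     -- Mathlib `Convex.isPreconnected`
import HarnessLib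

/-!
# S8 (R)′ ∕ (M) ∕ (V♭) letter `hW1`, THIRD FILE — `R90S8ResGMidAtomBotWildOfLocallyBoundedU3`: `g`-CONTINUITY OF THE CONTINUED EISENSTEIN FAMILY IS AUTOMATIC FROM THE JOINT LOCAL BOUND
# (Vitali-lite), so hW1_wild dies to local boundedness in `g` only

Track B ∕ R90-TF, crux h413 = `stmt-HodgeConjecture-24833`, route of record `HCCMUnconditional`; cell `hodgecm-mathlib`, R90-TF section S8 «ContSpec-n½», letter `hW1 : resGMidBlock ξ μω ≤
resGMidBlockτ ξ μω` of (R)′ :337 ∕ (M) :299 ∕ (V♭) :406; ruling J-S8-W1′ (hW1 = hW1_reg + hW1_wild).  THEOREMS ONLY (no `def`, no `instance`, no `notation`, no named-fact hypothesis, no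
`sorry`; default heartbeats); lane `--supports stmt-HodgeConjecture-24833 --as helper` (count-neutral).  CLOSES NO SOCKET.

THE QUESTION (S8-R251 (valve), VALVE 32 (mm)).  ★ D1 `resGMidAtomGen` carries, for the continued family `Ec` of a datum, holomorphy on `Ω = {1 < Re} ∖ Sp` POINTWISE IN `g` only; ★
`admissible_rightAverage` (LH4-p10 (g9)), the payer of ★ p865108's (hKreg), needs ESTATE T's `hE4 : ∀ z ∈ Ω, Continuous (Ec z)` and the joint local bound `hEbd`.  THIS FILE PROVES `hE4` FROM
`hEbd`, so the REGULAR data of ★ p865108 are the LOCALLY BOUNDED data and (hKwild) shrinks to «every τ-level atom is the closed span of the classes of its LOCALLY BOUNDED data».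
THE MATHEMATICS (Vitali–Montel in the small, [Conway1978] VII §2; Eisenstein input [MoeglinWaldspurger1995] II.1.5, IV.1.9–IV.1.11).  `F : ℂ → X → ℂ`, `z ↦ F z x`
holomorphic on an open preconnected `Ω` for `x ∈ S`, `(z, x) ↦ F z x` locally bounded on `Ω × S`, `x ↦ F w x` continuous on `S` for `w` near one point of `Ω`.  The set `T` of points near
which `x`-continuity holds is open, non-empty, and closed in `Ω`: at `z ∈ Ω ∩ closure T` take `closedBall z R₀ ⊆ Ω` with a uniform bound `M` (★ `exists_uniform_bound_of_locally_bounded`),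
`z′ ∈ T` within `R₀∕4`, a small circle `C(z′, ρ)` in the region of known continuity and the big circle `C(z′, 3R₀∕4)`; Cauchy (Mathlib `DifferentiableOn.hasFPowerSeriesOnBall`) expands
`F w x = Σ_n a_n(w, x)` on the big disc with `a_n` the SAME circle integral for either radius (Mathlib `HasFPowerSeriesAt.eq_formalMultilinearSeries`): the small circle gives `x`-continuity
of `a_n` (dominated convergence, `X` first countable), the big one `‖a_n‖ ≤ M (2∕3)ⁿ` on `ball z′ (R₀∕2) ∋ z`, so the sum is `x`-continuous there (Mathlib `continuousOn_tsum`): `z ∈ T`;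
Mathlib `IsPreconnected.subset_of_closure_inter_subset` gives `Ω ⊆ T` (§1).  §2: base region `{2 < Re}` (`Ec z = E(flat(φ, z))` continuous in `g`, ★
`continuous_eisensteinSeriesU_flatSectionU_cm_three`, `φ` bounded ★ `exists_bound_of_mem_chiSectionSpacePair_midBlock`); the slit half-plane is covered by the convex pieces `{1<Re, ±Im>0}`
and discs around its real points (the ★ `eqOn_reSlit_of_eqOn_re_gt` pattern); `S` = compact neighbourhoods (`G(𝔸)` locally compact, second countable ★).  §3 feeds `hE4` into ★ p865108.
* §1 **`continuousOn_apply_of_differentiableOn_of_locallyBounded`** (abstract Vitali-lite, any first-countable parameter space).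
* §2 `continuous_apply_of_differentiableOn_reSlit_of_locallyBounded` (the slit half-plane, any locally compact first-countable parameter space),
  **`continuous_midContinuation_apply_of_locallyBounded`** (= `hE4` of ★ `admissible_rightAverage` DISCHARGED from `hEbd` at every D1 datum).
* §3 HEADS: `locallyBounded_classes_subset_regular_classes`, **`hW1_of_locallyBounded (hFIN) (hKwildLB) (hKreg) : resGMidBlock L μ ξ μω ≤ resGMidBlockτ L μ ξ μω`** — ★ p865108
  `hW1_of_regular` with (hKwild) replaced by (hKwildLB) «every τ-level atom is the closed span of the classes of its LOCALLY BOUNDED data» (hW1_wild at locally UNBOUNDED data only).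
HONEST LABEL: HC_CM is proved only modulo the 7 printed citations (2 remaining named inputs: hLiu418 = `stmt-HodgeConjecture-24832`, h413 = `stmt-HodgeConjecture-24833`) until
rung 0 closes; REL ≠ ★ ≠ BUILT; this file PAYS NO SOCKET: hW1 = ★ ∘ {(hFIN) (K2E1-p14 (g5) ★ `hFIN_of_levelIdempotents` modulo its (hAVG)), (hKreg) (LH4-p10 (g9): ★ FILE 1 + FILE 2 in
flight), (hKwildLB) = hW1_wild at locally unbounded data (L, UNOWNED, unprinted)}; count-neutral.

## References
* [Conway1978] J. B. Conway, *Functions of One Complex Variable I* (2nd ed., 1978), IV §2 (Cauchy estimates), VII §2 (Montel).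
* [MoeglinWaldspurger1995] C. Mœglin, J.-L. Waldspurger, *Spectral Decomposition and Eisenstein Series* (1995), I.2.17, II.1.5, IV.1.9–IV.1.11, V.3.13.
* [BorelJacquet1979] A. Borel, H. Jacquet, *Automorphic forms and automorphic representations*, Corvallis PSPM 33.1 (1979), §4.1, §4.6.
* [Rogawski1990] J. D. Rogawski, *Automorphic Representations of Unitary Groups in Three Variables* (1990), §13.9 p. 229 (ii).
-/

set_option autoImplicit false
set_option linter.dupNamespace false  -- the mandated namespace `…HodgeConjecture.HodgeConjecture.R90.S8` (LEAD #1 L1) repeats the summit's segment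

noncomputable section

open MeasureTheory Measure Set Filter Topology Metric NumberField ContRepresentation
open Literature.NumberTheory Literature.NumberTheory.Automorphic Literature.NumberTheory.Automorphic.UnitaryGroup Literature.NumberTheory.GaloisRepresentations AdelicGroupData
open Literature.NumberTheory.Automorphic.Arthur2013.Leaves.TECR Literature.NumberTheory.Rogawski1990
open Literature.RepresentationTheory.CompactGroups
open Summit.HodgeConjecture.HodgeConjecture.Cruxes.H413.K2E1BorelEisensteinU
open Summit.HodgeConjecture.HodgeConjecture.Cruxes.H413.K2E1ChiSectionSpaceU3PairDefs
open Summit.HodgeConjecture.HodgeConjecture.Cruxes.H413.K2E1BorelEisensteinRegularCMThree (continuous_eisensteinSeriesU_flatSectionU_cm_three)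
open scoped ENNReal NNReal InnerProductSpace ComplexConjugate Real

namespace Summit.HodgeConjecture.HodgeConjecture.R90.S8

/-! ## §1 Abstract Vitali-lite: `x`-continuity propagates along `z`-holomorphy under a joint local bound -/

section Abstract

variable {X : Type*} [TopologicalSpace X] [FirstCountableTopology X]

/-- **VITALI-LITE — CONTINUITY IN THE PARAMETER PROPAGATES ALONG HOLOMORPHY UNDER A JOINT LOCAL BOUND.**  `F : ℂ → X → ℂ`; `Ω ⊆ ℂ` open and preconnected; `S ⊆ X`; for every `x ∈ S`,
`z ↦ F z x` is holomorphic on `Ω`; `(z, x) ↦ F z x` is locally bounded on `Ω × S` (`hbd`); and for all `w` in a neighbourhood of ONE point `z₀ ∈ Ω`, `x ↦ F w x` is continuous on `S`.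
THEN `x ↦ F z x` is continuous on `S` for EVERY `z ∈ Ω`.  (Clopen propagation: Taylor re-expansion on a disc inside `Ω` — Mathlib `DifferentiableOn.hasFPowerSeriesOnBall`, coefficients by
the Cauchy formula on a small circle in the known region (dominated convergence) and bounded via the big circle (Cauchy estimate), uniformly convergent sum — Mathlib `continuousOn_tsum`,
`IsPreconnected.subset_of_closure_inter_subset`.) [cite: Conway1978, VII §2] -/
theorem continuousOn_apply_of_differentiableOn_of_locallyBounded (F : ℂ → X → ℂ) {Ω : Set ℂ} (hΩo : IsOpen Ω) (hΩc : IsPreconnected Ω) (S : Set X)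
    (hol : ∀ x ∈ S, DifferentiableOn ℂ (fun z => F z x) Ω)
    (hbd : ∀ z₁ ∈ Ω, ∃ V ∈ 𝓝 z₁, ∃ M : ℝ, ∀ z ∈ V, ∀ x ∈ S, ‖F z x‖ ≤ M)
    {z₀ : ℂ} (hz₀ : z₀ ∈ Ω) (hbase : ∃ U ∈ 𝓝 z₀, ∀ w ∈ U, ContinuousOn (F w) S) :
    ∀ z ∈ Ω, ContinuousOn (F z) S := by
  -- the propagation set `T`
  set T : Set ℂ := {z | ∃ U ∈ 𝓝 z, ∀ w ∈ U, ContinuousOn (F w) S} with hT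
  have hTo : IsOpen T := by
    refine isOpen_iff_mem_nhds.2 fun z ⟨U, hU, hUc⟩ => ?_
    obtain ⟨U', hU'U, hU'o, hzU'⟩ := _root_.mem_nhds_iff.1 hU
    exact Filter.mem_of_superset (hU'o.mem_nhds hzU') fun z' hz' => ⟨U', hU'o.mem_nhds hz', fun w hw => hUc w (hU'U hw)⟩
  have hTself : ∀ z ∈ T, ContinuousOn (F z) S := fun z ⟨U, hU, hUc⟩ => hUc z (mem_of_mem_nhds hU)
  -- KEY: `closure T ∩ Ω ⊆ T`
  have hkey : closure T ∩ Ω ⊆ T := by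
    rintro z ⟨hzT, hzΩ⟩
    -- a closed disc around `z` inside `Ω`, with a uniform bound `M` on it
    obtain ⟨R₀, hR₀, hball⟩ : ∃ R₀ > 0, closedBall z R₀ ⊆ Ω := by
      obtain ⟨ε, hε, hεΩ⟩ := Metric.isOpen_iff.1 hΩo z hzΩ
      exact ⟨ε / 2, half_pos hε, (closedBall_subset_ball (half_lt_self hε)).trans hεΩ⟩
    obtain ⟨M, hM0, hM⟩ := exists_uniform_bound_of_locally_bounded (isCompact_closedBall z R₀) S F fun z₁ hz₁ => hbd z₁ (hball hz₁)
    -- a point `z'` of `T` within `R₀ / 4` of `z`, and a small radius `ρ` inside its region of known continuity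
    obtain ⟨r, hr, hr0⟩ : ∃ r : ℝ, r = R₀ / 4 ∧ 0 < r := ⟨R₀ / 4, rfl, by positivity⟩
    obtain ⟨z', hz'T, hzz'⟩ : ∃ z' ∈ T, dist z z' < r := Metric.mem_closure_iff.1 hzT r hr0
    obtain ⟨U, hU, hUc⟩ := hz'T
    obtain ⟨ε, hε, hεU⟩ := Metric.mem_nhds_iff.1 hU
    set ρ' : ℝ≥0 := ⟨min (ε / 2) r, (lt_min (half_pos hε) hr0).le⟩ with hρ'
    have hρ0 : (0 : ℝ) < ρ' := lt_min (half_pos hε) hr0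
    have hρr : (ρ' : ℝ) ≤ r := min_le_right _ _
    have hρU : closedBall z' (ρ' : ℝ) ⊆ U := (closedBall_subset_ball ((min_le_left _ _).trans_lt (half_lt_self hε))).trans hεU
    -- the big radius `3r`: `closedBall z' (3r) ⊆ closedBall z R₀ ⊆ Ω`
    have h3r0 : (0 : ℝ) < 3 * r := by positivity
    set R' : ℝ≥0 := ⟨3 * r, h3r0.le⟩ with hR'
    have hR'0 : (0 : ℝ) < R' := h3r0
    have hbig : closedBall z' (R' : ℝ) ⊆ closedBall z R₀ := fun y hy => mem_closedBall.2 (by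
      have hy' : dist y z' ≤ 3 * r := mem_closedBall.1 hy
      linarith [dist_triangle y z' z, dist_comm z' z])
    have hsmall : closedBall z' (ρ' : ℝ) ⊆ closedBall z R₀ :=
      (closedBall_subset_closedBall (show (ρ' : ℝ) ≤ (R' : ℝ) by change min (ε / 2) r ≤ 3 * r; linarith [min_le_right (ε / 2) r])).trans hbig
    -- the Taylor terms, written with the SMALL radius
    set a : ℕ → ℂ → X → ℂ := fun n w x => cauchyPowerSeries (fun ζ => F ζ x) z' ρ' n fun _ => w - z' with ha
    -- power series at both radii (for `x ∈ S`), and their agreement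
    have hpsρ : ∀ x ∈ S, HasFPowerSeriesOnBall (fun ζ => F ζ x) (cauchyPowerSeries (fun ζ => F ζ x) z' ρ') z' ρ' := fun x hx =>
      ((hol x hx).mono (hsmall.trans hball)).hasFPowerSeriesOnBall (NNReal.coe_pos.1 hρ0)
    have hpsR : ∀ x ∈ S, HasFPowerSeriesOnBall (fun ζ => F ζ x) (cauchyPowerSeries (fun ζ => F ζ x) z' R') z' R' := fun x hx =>
      ((hol x hx).mono (hbig.trans hball)).hasFPowerSeriesOnBall (NNReal.coe_pos.1 hR'0)
    have heq : ∀ x ∈ S, cauchyPowerSeries (fun ζ => F ζ x) z' ρ' = cauchyPowerSeries (fun ζ => F ζ x) z' R' := fun x hx =>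
      (hpsρ x hx).hasFPowerSeriesAt.eq_formalMultilinearSeries (hpsR x hx).hasFPowerSeriesAt
    -- (i) each term is continuous in `x` on `S` (dominated convergence on the small circle, which lies in `U`)
    have hcont : ∀ (n : ℕ) (w : ℂ), ContinuousOn (fun x => a n w x) S := by
      intro n w x₀ hx₀
      have hform : ∀ x, a n w x = (2 * π * Complex.I : ℂ)⁻¹ • ∫ θ in (0 : ℝ)..2 * π, deriv (circleMap z' ρ') θ •
          (((w - z') / (circleMap z' ρ' θ - z')) ^ n • ((circleMap z' ρ' θ - z')⁻¹ • F (circleMap z' ρ' θ) x)) := fun x => by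
        simp only [ha, cauchyPowerSeries_apply, circleIntegral]
      simp_rw [hform]
      refine ContinuousWithinAt.smul (continuousWithinAt_const (b := (2 * π * Complex.I : ℂ)⁻¹)) ?_
      have hζΩ : ∀ θ : ℝ, circleMap z' ρ' θ ∈ Ω := fun θ => hball (hsmall (circleMap_mem_closedBall z' hρ0.le θ))
      have hζU : ∀ θ : ℝ, circleMap z' ρ' θ ∈ U := fun θ => hρU (circleMap_mem_closedBall z' hρ0.le θ)
      have hζne : ∀ θ : ℝ, circleMap z' ρ' θ - z' ≠ 0 := fun θ => sub_ne_zero.2 (circleMap_ne_center hρ0.ne')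
      -- the integrand is continuous in `θ` for `x ∈ S`
      have hmeas : ∀ x ∈ S, Continuous fun θ : ℝ => deriv (circleMap z' ρ') θ • (((w - z') / (circleMap z' ρ' θ - z')) ^ n • ((circleMap z' ρ' θ - z')⁻¹ • F (circleMap z' ρ' θ) x)) := by
        intro x hx
        have hd : Continuous fun θ : ℝ => deriv (circleMap z' ρ') θ := by
          simp_rw [deriv_circleMap]
          exact (continuous_circleMap 0 ρ').mul continuous_const
        have hsub : Continuous fun θ : ℝ => circleMap z' ρ' θ - z' := (continuous_circleMap z' ρ').sub continuous_const
        have hF : Continuous fun θ : ℝ => F (circleMap z' ρ' θ) x := ((hol x hx).continuousOn).comp_continuous (continuous_circleMap z' ρ') hζΩ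
        exact hd.smul (((continuous_const.div hsub hζne).pow n).smul ((hsub.inv₀ hζne).smul hF))
      -- the uniform bound on the integrand
      set C : ℝ := |(ρ' : ℝ)| * ((‖w - z'‖ / |(ρ' : ℝ)|) ^ n * (|(ρ' : ℝ)|⁻¹ * M)) with hC
      have hbound : ∀ x ∈ S, ∀ θ : ℝ, ‖deriv (circleMap z' ρ') θ • (((w - z') / (circleMap z' ρ' θ - z')) ^ n • ((circleMap z' ρ' θ - z')⁻¹ • F (circleMap z' ρ' θ) x))‖ ≤ C := by
        intro x hx θ
        have hn : ‖circleMap z' ρ' θ - z'‖ = |(ρ' : ℝ)| := by rw [circleMap_sub_center, norm_circleMap_zero]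
        rw [_root_.norm_smul, _root_.norm_smul, _root_.norm_smul, deriv_circleMap, norm_mul, Complex.norm_I, mul_one, norm_circleMap_zero, norm_pow, norm_div, hn,
          norm_inv, hn]
        refine mul_le_mul_of_nonneg_left (mul_le_mul_of_nonneg_left (mul_le_mul_of_nonneg_left (hM _ (hsmall (circleMap_mem_closedBall z' hρ0.le θ)) x hx) (inv_nonneg.2 (abs_nonneg _)))
          (pow_nonneg (div_nonneg (norm_nonneg _) (abs_nonneg _)) _)) (abs_nonneg _)
      refine intervalIntegral.continuousWithinAt_of_dominated_interval (bound := fun _ => C) ?_ ?_ intervalIntegrable_const ?_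
      · exact Filter.eventually_of_mem self_mem_nhdsWithin fun x hx => (hmeas x hx).aestronglyMeasurable
      · exact Filter.eventually_of_mem self_mem_nhdsWithin fun x hx => Filter.Eventually.of_forall fun θ _ => hbound x hx θ
      · refine Filter.Eventually.of_forall fun θ _ => ?_
        exact ContinuousWithinAt.smul (continuousWithinAt_const (b := deriv (circleMap z' ρ') θ))
          (ContinuousWithinAt.smul (continuousWithinAt_const (b := ((w - z') / (circleMap z' ρ' θ - z')) ^ n))
            (ContinuousWithinAt.smul (continuousWithinAt_const (b := (circleMap z' ρ' θ - z')⁻¹)) ((hUc _ (hζU θ)) x₀ hx₀)))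
    -- (ii) the terms are bounded by `M (2/3)ⁿ` for `w ∈ ball z' (2r)`, `x ∈ S` (Cauchy estimate on the big circle)
    have hterm : ∀ (n : ℕ), ∀ w ∈ ball z' (2 * r), ∀ x ∈ S, ‖a n w x‖ ≤ M * (2 / 3) ^ n := by
      intro n w hw x hx
      rw [mem_ball] at hw
      have hwle : ‖w - z'‖ / (R' : ℝ) ≤ 2 / 3 := by
        rw [div_le_div_iff₀ hR'0 (by norm_num), ← dist_eq_norm]
        change dist w z' * 3 ≤ 2 * (3 * r)
        linarith
      have hform : a n w x = (2 * π * Complex.I : ℂ)⁻¹ • ∮ ζ in C(z', (R' : ℝ)), ((w - z') / (ζ - z')) ^ n • ((ζ - z')⁻¹ • F ζ x) := by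
        rw [show a n w x = cauchyPowerSeries (fun ζ => F ζ x) z' ρ' n (fun _ => w - z') from rfl, heq x hx, cauchyPowerSeries_apply]
      rw [hform, _root_.norm_smul]
      have hint : ‖∮ ζ in C(z', (R' : ℝ)), ((w - z') / (ζ - z')) ^ n • ((ζ - z')⁻¹ • F ζ x)‖ ≤ 2 * π * (R' : ℝ) * ((‖w - z'‖ / (R' : ℝ)) ^ n * ((R' : ℝ)⁻¹ * M)) := by
        refine circleIntegral.norm_integral_le_of_norm_le_const hR'0.le fun ζ hζ => ?_
        have hζn : ‖ζ - z'‖ = (R' : ℝ) := by rwa [mem_sphere, dist_eq_norm] at hζ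
        have hζb : ζ ∈ closedBall z R₀ := hbig (sphere_subset_closedBall hζ)
        rw [_root_.norm_smul, _root_.norm_smul, norm_pow, norm_div, hζn, norm_inv, hζn]
        exact mul_le_mul (le_refl _) (mul_le_mul_of_nonneg_left (hM ζ hζb x hx) (inv_nonneg.2 hR'0.le)) (by positivity) (by positivity)
      rw [show ‖(2 * π * Complex.I : ℂ)⁻¹‖ = (2 * π)⁻¹ by
        rw [norm_inv, norm_mul, Complex.norm_I, mul_one, Complex.norm_mul, Complex.norm_ofNat, Complex.norm_real, Real.norm_eq_abs, _root_.abs_of_pos Real.pi_pos]]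
      calc (2 * π)⁻¹ * ‖∮ ζ in C(z', (R' : ℝ)), ((w - z') / (ζ - z')) ^ n • ((ζ - z')⁻¹ • F ζ x)‖
          ≤ (2 * π)⁻¹ * (2 * π * (R' : ℝ) * ((‖w - z'‖ / (R' : ℝ)) ^ n * ((R' : ℝ)⁻¹ * M))) := mul_le_mul_of_nonneg_left hint (by positivity)
        _ = M * (‖w - z'‖ / (R' : ℝ)) ^ n := by field_simp
        _ ≤ M * (2 / 3) ^ n := mul_le_mul_of_nonneg_left (pow_le_pow_left₀ (by positivity) hwle n) hM0
    -- (iii) on `ball z' (2r)` the function is the sum of the terms (for `x ∈ S`)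
    have hsum : ∀ w ∈ ball z' (2 * r), ∀ x ∈ S, F w x = ∑' n, a n w x := by
      intro w hw x hx
      have hy : w ∈ Metric.eball z' (R' : ℝ≥0∞) := by
        rw [Metric.mem_eball, edist_nndist, ENNReal.coe_lt_coe, ← NNReal.coe_lt_coe, coe_nndist]
        change dist w z' < 3 * r
        linarith [mem_ball.1 hw]
      have h := (hpsR x hx).hasSum_sub hy
      rw [← heq x hx] at h
      exact h.tsum_eq.symm
    -- (iv) hence `x ↦ F w x` is continuous on `S` for every `w ∈ ball z' (2r)`: `z ∈ T`
    refine ⟨ball z' (2 * r), isOpen_ball.mem_nhds (mem_ball.2 (by linarith [dist_comm z z'])), fun w hw => ?_⟩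
    have hts : ContinuousOn (fun x => ∑' n, a n w x) S :=
      continuousOn_tsum (fun n => hcont n w) ((summable_geometric_of_lt_one (by norm_num) (by norm_num)).mul_left M) fun n x hx => hterm n w hw x hx
    exact hts.congr fun x hx => hsum w hw x hx
  have hsub : Ω ⊆ T := hΩc.subset_of_closure_inter_subset hTo ⟨z₀, hz₀, hbase⟩ hkey
  exact fun z hz => hTself z (hsub hz)

end Abstract

/-! ## §2 The slit half-plane `{1 < Re} ∖ Sp` and the D1 data: `hE4` from `hEbd` -/

section Slit

variable {X : Type*} [TopologicalSpace X] [FirstCountableTopology X] [LocallyCompactSpace X]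

/-- **`x`-CONTINUITY ON THE SLIT HALF-PLANE FROM A JOINT LOCAL BOUND.**  `F : ℂ → X → ℂ` with `z ↦ F z x` holomorphic on `Ω = {1 < Re} ∖ Sp` (`Sp` a finite set of REAL points) for
every `x`, `(z, x) ↦ F z x` locally bounded on `Ω × S` for every compact `S`, and `x ↦ F w x` continuous for `2 < Re w`.  THEN `x ↦ F z x` is continuous for every `z ∈ Ω` — §1 on the
convex pieces `{1<Re} ∩ {0<Im}`, `{1<Re} ∩ {Im<0}` (base point `3 ± i`) and on a disc around each real point of `Ω` (base point in the upper piece), `S` a compact neighbourhood of the point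
at hand (`X` locally compact). [cite: Conway1978, VII §2] -/
theorem continuous_apply_of_differentiableOn_reSlit_of_locallyBounded (F : ℂ → X → ℂ) (Sp : Finset ℂ) (hSp : ∀ s ∈ Sp, s.im = 0)
    (hol : ∀ x, DifferentiableOn ℂ (fun z => F z x) ({z : ℂ | 1 < z.re} \ (↑Sp : Set ℂ)))
    (hbd : ∀ z₁ ∈ ({z : ℂ | 1 < z.re} \ (↑Sp : Set ℂ)), ∀ S : Set X, IsCompact S → ∃ V ∈ 𝓝 z₁, ∃ M : ℝ, ∀ z ∈ V, ∀ x ∈ S, ‖F z x‖ ≤ M)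
    (hbase : ∀ w : ℂ, 2 < w.re → Continuous (F w)) :
    ∀ z ∈ ({z : ℂ | 1 < z.re} \ (↑Sp : Set ℂ)), Continuous (F z) := by
  have hopen : IsOpen ({z : ℂ | 1 < z.re} \ (↑Sp : Set ℂ)) := (isOpen_lt continuous_const Complex.continuous_re).sdiff Sp.finite_toSet.isClosed
  -- §1 on a sub-region `Ω' ⊆ Ω` for a compact `S`
  have hprop : ∀ (Ω' : Set ℂ), IsOpen Ω' → IsPreconnected Ω' → Ω' ⊆ ({z : ℂ | 1 < z.re} \ (↑Sp : Set ℂ)) → ∀ S : Set X, IsCompact S →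
      ∀ z₀ ∈ Ω', (∃ U ∈ 𝓝 z₀, ∀ w ∈ U, ContinuousOn (F w) S) → ∀ z ∈ Ω', ContinuousOn (F z) S := by
    exact fun Ω' hΩ'o hΩ'c hΩ'sub S hS z₀ hz₀ hb => continuousOn_apply_of_differentiableOn_of_locallyBounded F hΩ'o hΩ'c S (fun x _ => (hol x).mono hΩ'sub) (fun z₁ hz₁ => hbd z₁ (hΩ'sub hz₁) S hS) hz₀ hb
  -- the two convex pieces
  have hup : ∀ S : Set X, IsCompact S → ∀ z ∈ ({z : ℂ | 1 < z.re} ∩ {z : ℂ | 0 < z.im}), ContinuousOn (F z) S := by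
    intro S hS
    have hsub : {z : ℂ | 1 < z.re} ∩ {z : ℂ | 0 < z.im} ⊆ {z : ℂ | 1 < z.re} \ (↑Sp : Set ℂ) := fun z hz => ⟨hz.1, fun hs => by
      have h : (0 : ℝ) < z.im := hz.2
      rw [hSp z hs] at h
      exact lt_irrefl _ h⟩
    refine hprop _ ((isOpen_lt continuous_const Complex.continuous_re).inter (isOpen_lt continuous_const Complex.continuous_im))
      (((convex_halfSpace_re_gt (1 : ℝ)).inter (convex_halfSpace_im_gt (0 : ℝ))).isPreconnected) hsub S hS (3 + Complex.I) ⟨by norm_num, by norm_num⟩ ?_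
    exact ⟨{z : ℂ | 2 < z.re}, (isOpen_lt continuous_const Complex.continuous_re).mem_nhds (by norm_num), fun w hw => (hbase w hw).continuousOn⟩
  have hdown : ∀ S : Set X, IsCompact S → ∀ z ∈ ({z : ℂ | 1 < z.re} ∩ {z : ℂ | z.im < 0}), ContinuousOn (F z) S := by
    intro S hS
    have hsub : {z : ℂ | 1 < z.re} ∩ {z : ℂ | z.im < 0} ⊆ {z : ℂ | 1 < z.re} \ (↑Sp : Set ℂ) := fun z hz => ⟨hz.1, fun hs => by
      have h : z.im < (0 : ℝ) := hz.2
      rw [hSp z hs] at h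
      exact lt_irrefl _ h⟩
    refine hprop _ ((isOpen_lt continuous_const Complex.continuous_re).inter (isOpen_lt Complex.continuous_im continuous_const))
      (((convex_halfSpace_re_gt (1 : ℝ)).inter (convex_halfSpace_im_lt (0 : ℝ))).isPreconnected) hsub S hS (3 - Complex.I) ⟨by norm_num, by norm_num⟩ ?_
    exact ⟨{z : ℂ | 2 < z.re}, (isOpen_lt continuous_const Complex.continuous_re).mem_nhds (by norm_num), fun w hw => (hbase w hw).continuousOn⟩
  -- every point of `Ω`, on every compact `S`
  have hall : ∀ S : Set X, IsCompact S → ∀ z ∈ ({z : ℂ | 1 < z.re} \ (↑Sp : Set ℂ)), ContinuousOn (F z) S := by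
    intro S hS z hz
    rcases lt_trichotomy 0 z.im with him | him | him
    · exact hup S hS z ⟨hz.1, him⟩
    · -- a real point of `Ω`: §1 on a disc around it, base point in the upper piece
      obtain ⟨δ, hδ, hδΩ⟩ := Metric.isOpen_iff.1 hopen z hz
      have hzδ : z + ((δ / 2 : ℝ) : ℂ) * Complex.I ∈ ball z δ := by
        rw [mem_ball, dist_eq_norm, add_sub_cancel_left, norm_mul, Complex.norm_I, mul_one, Complex.norm_real, Real.norm_eq_abs, abs_of_pos (half_pos hδ)]
        exact half_lt_self hδ
      have h1 : 1 < z.re := hz.1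
      have hzup : z + ((δ / 2 : ℝ) : ℂ) * Complex.I ∈ {z : ℂ | 1 < z.re} ∩ {z : ℂ | 0 < z.im} :=
        ⟨show 1 < (z + ((δ / 2 : ℝ) : ℂ) * Complex.I).re by simpa using h1, show 0 < (z + ((δ / 2 : ℝ) : ℂ) * Complex.I).im by simp [← him, hδ]⟩
      refine hprop (ball z δ) isOpen_ball (convex_ball z δ).isPreconnected hδΩ S hS _ hzδ ?_ z (mem_ball_self hδ)
      exact ⟨{z : ℂ | 1 < z.re} ∩ {z : ℂ | 0 < z.im}, ((isOpen_lt continuous_const Complex.continuous_re).inter (isOpen_lt continuous_const Complex.continuous_im)).mem_nhds hzup,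
        fun w hw => hup S hS w hw⟩
    · exact hdown S hS z ⟨hz.1, him⟩
  -- continuity is local: compact neighbourhoods
  refine fun z hz => continuous_iff_continuousAt.2 fun x₀ => ?_
  obtain ⟨S, hS, hSx⟩ := exists_compact_mem_nhds x₀
  exact (hall S hS z hz).continuousAt hSx

variable (L : Type) [Field L] [NumberField L] [IsCMField L]

/-- **`hE4` FROM `hEbd` AT EVERY D1 DATUM — `g`-CONTINUITY OF THE CONTINUED EISENSTEIN FAMILY IS AUTOMATIC.**  For a continuous section `φ ∈ V(ξ.bcη⁻¹·ξ.bcψ⁻¹·μω, ξ.ψ; K′, ω)` (`μω` unitary, so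
`φ` is bounded ★ `exists_bound_of_mem_chiSectionSpacePair_midBlock`), a family `Ec` holomorphic on `{1 < Re} ∖ Sp` pointwise in `g` (`Sp` real, ★ D1's clause) with `Ec z = E(flat(φ, z))` on
`{2 < Re}` (★ D1's clause; continuous in `g` there, ★ `continuous_eisensteinSeriesU_flatSectionU_cm_three`), ESTATE T's joint local bound `hEbd` (★ `admissible_rightAverage`'s :318 bytes)
IMPLIES its `hE4` (:317): `∀ z ∈ {1<Re}∖Sp, Continuous (Ec z)`.  (`G(𝔸)` is first countable and locally compact ★.) [cite: MoeglinWaldspurger1995, II.1.5, IV.1.9–IV.1.11] [cite: Conway1978, VII §2] -/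
theorem continuous_midContinuation_apply_of_locallyBounded (ξ : OneDimAutRepH L) {μω : HeckeCharacter L} (hμω : μω.IsUnitary)
    {K' : Subgroup (quasiSplit (↥(maximalRealSubfield L)) L (IsCMField.complexConj L) 3).Adelic} {ω : ↥K' → ℂ}
    {φ : (quasiSplit (↥(maximalRealSubfield L)) L (IsCMField.complexConj L) 3).Adelic → ℂ} (hφV : φ ∈ chiSectionSpacePair (ξ.bcη⁻¹ * ξ.bcψ⁻¹ * μω) ξ.ψ K' ω) (hφc : Continuous φ)
    (Ec : ℂ → (quasiSplit (↥(maximalRealSubfield L)) L (IsCMField.complexConj L) 3).Adelic → ℂ) (Sp : Finset ℂ) (hSp : ∀ s ∈ Sp, s.im = 0)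
    (hol : ∀ g, DifferentiableOn ℂ (fun z => Ec z g) ({z : ℂ | 1 < z.re} \ (↑Sp : Set ℂ)))
    (hEbd : ∀ z₁ ∈ ({z : ℂ | 1 < z.re} \ (↑Sp : Set ℂ)), ∀ S : Set (quasiSplit (↥(maximalRealSubfield L)) L (IsCMField.complexConj L) 3).Adelic, IsCompact S → ∃ V ∈ 𝓝 z₁, ∃ M : ℝ, ∀ z ∈ V, ∀ g ∈ S, ‖Ec z g‖ ≤ M)
    (hEc2 : ∀ z : ℂ, 2 < z.re → Ec z = eisensteinSeriesU (flatSectionU φ z)) :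
    ∀ z ∈ ({z : ℂ | 1 < z.re} \ (↑Sp : Set ℂ)), Continuous (Ec z) := by
  haveI : LocallyCompactSpace (quasiSplit (↥(maximalRealSubfield L)) L (IsCMField.complexConj L) 3).Adelic :=
    locallyCompactSpace_cmDatum_Adelic L 3 ((StdForm.antidiagonal 3).over L)
  haveI : SecondCountableTopology (quasiSplit (↥(maximalRealSubfield L)) L (IsCMField.complexConj L) 3).Adelic :=
    secondCountableTopology_cmDatum_Adelic L 3 ((StdForm.antidiagonal 3).over L)
  obtain ⟨M, hφM⟩ := exists_bound_of_mem_chiSectionSpacePair_midBlock L ξ hμω hφV hφc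
  refine continuous_apply_of_differentiableOn_reSlit_of_locallyBounded Ec Sp hSp hol hEbd fun w hw => ?_
  rw [hEc2 w hw]
  exact continuous_eisensteinSeriesU_flatSectionU_cm_three L hw hφc hφM

end Slit

/-! ## §3 HEADS: the regular data of ★ p865108 are the locally bounded data; `hW1` with the wild letter at locally unbounded data only -/

section Heads

variable (L : Type) [Field L] [NumberField L] [IsCMField L]
  (μ : Measure (quasiSplit (↥(maximalRealSubfield L)) L (IsCMField.complexConj L) 3).automorphicQuotient)
  (ξ : OneDimAutRepH L) {μω : HeckeCharacter L}

/-- **THE CLASSES OF LOCALLY BOUNDED τ-LEVEL DATA ARE CLASSES OF REGULAR DATA** (`hE4` supplied by §2): the set-builder of ★ p865108's (hKwild) with the continuity clause removed is contained in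
the one with it. [cite: MoeglinWaldspurger1995, IV.1.9–IV.1.11] -/
theorem locallyBounded_classes_subset_regular_classes (hμω : μω.IsUnitary)
    (U₀ : Subgroup ↥(finAdelic (↥(maximalRealSubfield L)) L (IsCMField.complexConj L) 3 ((StdForm.antidiagonal 3).over L))) :
    {f : (quasiSplit (↥(maximalRealSubfield L)) L (IsCMField.complexConj L) 3).L2 μ |
      ∃ (φ : (quasiSplit (↥(maximalRealSubfield L)) L (IsCMField.complexConj L) 3).Adelic → ℂ)
        (_ : φ ∈ chiSectionSpacePair (ξ.bcη⁻¹ * ξ.bcψ⁻¹ * μω) ξ.ψ (tauLevel L U₀) ((1 : ↥(tauLevel L U₀) →* ℂ) : ↥(tauLevel L U₀) → ℂ)) (_ : Continuous φ)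
        (Ec : ℂ → (quasiSplit (↥(maximalRealSubfield L)) L (IsCMField.complexConj L) 3).Adelic → ℂ) (Sp : Finset ℂ)
        (_ : ∀ s ∈ Sp, s.im = 0 ∧ 1 < s.re ∧ s.re ≤ 2)
        (_ : ∀ g, DifferentiableOn ℂ (fun z => Ec z g) ({z : ℂ | 1 < z.re} \ (↑Sp : Set ℂ)))
        (_ : ∀ z₁ ∈ ({z : ℂ | 1 < z.re} \ (↑Sp : Set ℂ)), ∀ S : Set (quasiSplit (↥(maximalRealSubfield L)) L (IsCMField.complexConj L) 3).Adelic, IsCompact S → ∃ V ∈ 𝓝 z₁, ∃ M : ℝ, ∀ z ∈ V, ∀ g ∈ S, ‖Ec z g‖ ≤ M)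
        (_ : ∀ z : ℂ, 2 < z.re → Ec z = eisensteinSeriesU (flatSectionU φ z))
        (Fp : (quasiSplit (↥(maximalRealSubfield L)) L (IsCMField.complexConj L) 3).Adelic → ℂ → ℂ)
        (_ : ∀ g, AnalyticAt ℂ (Fp g) ((3 : ℂ) / 2))
        (_ : ∀ g, Fp g =ᶠ[𝓝[≠] ((3 : ℂ) / 2)] fun z => (z - (3 : ℂ) / 2) * Ec z g),
        (f : (quasiSplit (↥(maximalRealSubfield L)) L (IsCMField.complexConj L) 3).automorphicQuotient → ℂ) =ᵐ[μ]
          fun x => Fp (Quotient.out (x : (quasiSplit (↥(maximalRealSubfield L)) L (IsCMField.complexConj L) 3).Adelic ⧸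
            (quasiSplit (↥(maximalRealSubfield L)) L (IsCMField.complexConj L) 3).quotientSubgroup))⁻¹ ((3 : ℂ) / 2)} ⊆
    {f : (quasiSplit (↥(maximalRealSubfield L)) L (IsCMField.complexConj L) 3).L2 μ |
      ∃ (φ : (quasiSplit (↥(maximalRealSubfield L)) L (IsCMField.complexConj L) 3).Adelic → ℂ)
        (_ : φ ∈ chiSectionSpacePair (ξ.bcη⁻¹ * ξ.bcψ⁻¹ * μω) ξ.ψ (tauLevel L U₀) ((1 : ↥(tauLevel L U₀) →* ℂ) : ↥(tauLevel L U₀) → ℂ)) (_ : Continuous φ)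
        (Ec : ℂ → (quasiSplit (↥(maximalRealSubfield L)) L (IsCMField.complexConj L) 3).Adelic → ℂ) (Sp : Finset ℂ)
        (_ : ∀ s ∈ Sp, s.im = 0 ∧ 1 < s.re ∧ s.re ≤ 2)
        (_ : ∀ g, DifferentiableOn ℂ (fun z => Ec z g) ({z : ℂ | 1 < z.re} \ (↑Sp : Set ℂ)))
        (_ : ∀ z ∈ ({z : ℂ | 1 < z.re} \ (↑Sp : Set ℂ)), Continuous (Ec z))
        (_ : ∀ z₁ ∈ ({z : ℂ | 1 < z.re} \ (↑Sp : Set ℂ)), ∀ S : Set (quasiSplit (↥(maximalRealSubfield L)) L (IsCMField.complexConj L) 3).Adelic, IsCompact S → ∃ V ∈ 𝓝 z₁, ∃ M : ℝ, ∀ z ∈ V, ∀ g ∈ S, ‖Ec z g‖ ≤ M)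
        (_ : ∀ z : ℂ, 2 < z.re → Ec z = eisensteinSeriesU (flatSectionU φ z))
        (Fp : (quasiSplit (↥(maximalRealSubfield L)) L (IsCMField.complexConj L) 3).Adelic → ℂ → ℂ)
        (_ : ∀ g, AnalyticAt ℂ (Fp g) ((3 : ℂ) / 2))
        (_ : ∀ g, Fp g =ᶠ[𝓝[≠] ((3 : ℂ) / 2)] fun z => (z - (3 : ℂ) / 2) * Ec z g),
        (f : (quasiSplit (↥(maximalRealSubfield L)) L (IsCMField.complexConj L) 3).automorphicQuotient → ℂ) =ᵐ[μ]
          fun x => Fp (Quotient.out (x : (quasiSplit (↥(maximalRealSubfield L)) L (IsCMField.complexConj L) 3).Adelic ⧸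
            (quasiSplit (↥(maximalRealSubfield L)) L (IsCMField.complexConj L) 3).quotientSubgroup))⁻¹ ((3 : ℂ) / 2)} := by
  rintro f ⟨φ, hφV, hφc, Ec, Sp, hSp, hol, hEbd, hEc2, Fp, hFp, hFpE, hae⟩
  exact ⟨φ, hφV, hφc, Ec, Sp, hSp, hol, continuous_midContinuation_apply_of_locallyBounded L ξ hμω hφV hφc Ec Sp (fun s hs => (hSp s hs).1) hol hEbd hEc2, hEbd, hEc2, Fp, hFp, hFpE, hae⟩

variable [(quasiSplit (↥(maximalRealSubfield L)) L (IsCMField.complexConj L) 3).IsAutomorphicMeasure μ]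
  [MeasurableSpace ↥(UnitaryGroup.arch (↥(maximalRealSubfield L)) L (IsCMField.complexConj L) 3 ((StdForm.antidiagonal 3).over L) ⊓ unitaryGroupOfForm (conjMixed (↥(maximalRealSubfield L)) L (IsCMField.complexConj L)) 1)]
  [BorelSpace ↥(UnitaryGroup.arch (↥(maximalRealSubfield L)) L (IsCMField.complexConj L) 3 ((StdForm.antidiagonal 3).over L) ⊓ unitaryGroupOfForm (conjMixed (↥(maximalRealSubfield L)) L (IsCMField.complexConj L)) 1)]
  (μK : Measure ↥(UnitaryGroup.arch (↥(maximalRealSubfield L)) L (IsCMField.complexConj L) 3 ((StdForm.antidiagonal 3).over L) ⊓ unitaryGroupOfForm (conjMixed (↥(maximalRealSubfield L)) L (IsCMField.complexConj L)) 1))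
  [IsProbabilityMeasure μK] [μK.IsMulLeftInvariant]

/-- **HEAD — `hW1` OF (R)′ ∕ (M) ∕ (V♭) WITH THE WILD LETTER AT LOCALLY UNBOUNDED DATA ONLY**: `resGMidBlock L μ ξ μω ≤ resGMidBlockτ L μ ξ μω` from (hFIN) (finite-adelic smoothing, ★
`hFIN_of_levelIdempotents` modulo its (hAVG)), (hKreg) (★ p865108's datum-level `K_∞`-type letter over REGULAR data = ★ `admissible_rightAverage` + LH4-p10 (g9)'s class bridge, by name)
and **(hKwildLB)** «every τ-level atom is the closed span of the classes of its LOCALLY BOUNDED data» (★ p865108's (hKwild) WITHOUT the `g`-continuity clause — supplied here by §2):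
hW1_wild now lives at data whose continuation is NOT locally bounded in `g` (L, unowned, unprinted — honest).  `μω` unitary (`hμu` of every socket frame).
[cite: MoeglinWaldspurger1995, I.2.17, II.1, IV.1.11, V.3.13] [cite: Conway1978, VII §2] [cite: Rogawski1990, §13.9 p. 229 (ii)] -/
theorem hW1_of_locallyBounded (hμω : μω.IsUnitary)
    (hFIN : resGMidAtom L μ ξ μω ⊥ 1 ≤
      (⨆ (U₀ : Subgroup ↥(finAdelic (↥(maximalRealSubfield L)) L (IsCMField.complexConj L) 3 ((StdForm.antidiagonal 3).over L))) (_ : IsTauLevel L U₀),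
        resGMidAtom L μ ξ μω (tauLevel L U₀) 1).topologicalClosure)
    (hKwildLB : ∀ (U₀ : Subgroup ↥(finAdelic (↥(maximalRealSubfield L)) L (IsCMField.complexConj L) 3 ((StdForm.antidiagonal 3).over L))) (_ : IsTauLevel L U₀),
      resGMidAtom L μ ξ μω (tauLevel L U₀) 1 ≤
        (Submodule.span ℂ {f : (quasiSplit (↥(maximalRealSubfield L)) L (IsCMField.complexConj L) 3).L2 μ |
          ∃ (φ : (quasiSplit (↥(maximalRealSubfield L)) L (IsCMField.complexConj L) 3).Adelic → ℂ)
            (_ : φ ∈ chiSectionSpacePair (ξ.bcη⁻¹ * ξ.bcψ⁻¹ * μω) ξ.ψ (tauLevel L U₀) ((1 : ↥(tauLevel L U₀) →* ℂ) : ↥(tauLevel L U₀) → ℂ)) (_ : Continuous φ)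
            (Ec : ℂ → (quasiSplit (↥(maximalRealSubfield L)) L (IsCMField.complexConj L) 3).Adelic → ℂ) (Sp : Finset ℂ)
            (_ : ∀ s ∈ Sp, s.im = 0 ∧ 1 < s.re ∧ s.re ≤ 2)
            (_ : ∀ g, DifferentiableOn ℂ (fun z => Ec z g) ({z : ℂ | 1 < z.re} \ (↑Sp : Set ℂ)))
            (_ : ∀ z₁ ∈ ({z : ℂ | 1 < z.re} \ (↑Sp : Set ℂ)), ∀ S : Set (quasiSplit (↥(maximalRealSubfield L)) L (IsCMField.complexConj L) 3).Adelic, IsCompact S → ∃ V ∈ 𝓝 z₁, ∃ M : ℝ, ∀ z ∈ V, ∀ g ∈ S, ‖Ec z g‖ ≤ M)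
            (_ : ∀ z : ℂ, 2 < z.re → Ec z = eisensteinSeriesU (flatSectionU φ z))
            (Fp : (quasiSplit (↥(maximalRealSubfield L)) L (IsCMField.complexConj L) 3).Adelic → ℂ → ℂ)
            (_ : ∀ g, AnalyticAt ℂ (Fp g) ((3 : ℂ) / 2))
            (_ : ∀ g, Fp g =ᶠ[𝓝[≠] ((3 : ℂ) / 2)] fun z => (z - (3 : ℂ) / 2) * Ec z g),
            (f : (quasiSplit (↥(maximalRealSubfield L)) L (IsCMField.complexConj L) 3).automorphicQuotient → ℂ) =ᵐ[μ]
              fun x => Fp (Quotient.out (x : (quasiSplit (↥(maximalRealSubfield L)) L (IsCMField.complexConj L) 3).Adelic ⧸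
                (quasiSplit (↥(maximalRealSubfield L)) L (IsCMField.complexConj L) 3).quotientSubgroup))⁻¹ ((3 : ℂ) / 2)}).topologicalClosure)
    (hKreg : ∀ (U₀ : Subgroup ↥(finAdelic (↥(maximalRealSubfield L)) L (IsCMField.complexConj L) 3 ((StdForm.antidiagonal 3).over L))) (_ : IsTauLevel L U₀)
      (φ : (quasiSplit (↥(maximalRealSubfield L)) L (IsCMField.complexConj L) 3).Adelic → ℂ)
      (_ : φ ∈ chiSectionSpacePair (ξ.bcη⁻¹ * ξ.bcψ⁻¹ * μω) ξ.ψ (tauLevel L U₀) ((1 : ↥(tauLevel L U₀) →* ℂ) : ↥(tauLevel L U₀) → ℂ)) (_ : Continuous φ)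
      (Ec : ℂ → (quasiSplit (↥(maximalRealSubfield L)) L (IsCMField.complexConj L) 3).Adelic → ℂ) (Sp : Finset ℂ)
      (_ : ∀ s ∈ Sp, s.im = 0 ∧ 1 < s.re ∧ s.re ≤ 2)
      (_ : ∀ g, DifferentiableOn ℂ (fun z => Ec z g) ({z : ℂ | 1 < z.re} \ (↑Sp : Set ℂ)))
      (_ : ∀ z ∈ ({z : ℂ | 1 < z.re} \ (↑Sp : Set ℂ)), Continuous (Ec z))
      (_ : ∀ z₁ ∈ ({z : ℂ | 1 < z.re} \ (↑Sp : Set ℂ)), ∀ S : Set (quasiSplit (↥(maximalRealSubfield L)) L (IsCMField.complexConj L) 3).Adelic, IsCompact S → ∃ V ∈ 𝓝 z₁, ∃ M : ℝ, ∀ z ∈ V, ∀ g ∈ S, ‖Ec z g‖ ≤ M)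
      (_ : ∀ z : ℂ, 2 < z.re → Ec z = eisensteinSeriesU (flatSectionU φ z))
      (Fp : (quasiSplit (↥(maximalRealSubfield L)) L (IsCMField.complexConj L) 3).Adelic → ℂ → ℂ)
      (_ : ∀ g, AnalyticAt ℂ (Fp g) ((3 : ℂ) / 2))
      (_ : ∀ g, Fp g =ᶠ[𝓝[≠] ((3 : ℂ) / 2)] fun z => (z - (3 : ℂ) / 2) * Ec z g)
      (f : (quasiSplit (↥(maximalRealSubfield L)) L (IsCMField.complexConj L) 3).L2 μ)
      (_ : (f : (quasiSplit (↥(maximalRealSubfield L)) L (IsCMField.complexConj L) 3).automorphicQuotient → ℂ) =ᵐ[μ]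
        fun x => Fp (Quotient.out (x : (quasiSplit (↥(maximalRealSubfield L)) L (IsCMField.complexConj L) 3).Adelic ⧸
          (quasiSplit (↥(maximalRealSubfield L)) L (IsCMField.complexConj L) 3).quotientSubgroup))⁻¹ ((3 : ℂ) / 2))
      (E : Type) [NormedAddCommGroup E] [InnerProductSpace ℂ E] [FiniteDimensional ℂ E]
      (τ : ContRepresentation ℂ ↥(UnitaryGroup.arch (↥(maximalRealSubfield L)) L (IsCMField.complexConj L) 3 ((StdForm.antidiagonal 3).over L) ⊓ unitaryGroupOfForm (conjMixed (↥(maximalRealSubfield L)) L (IsCMField.complexConj L)) 1) E)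
      (_ : Continuous (τ : ↥(UnitaryGroup.arch (↥(maximalRealSubfield L)) L (IsCMField.complexConj L) 3 ((StdForm.antidiagonal 3).over L) ⊓ unitaryGroupOfForm (conjMixed (↥(maximalRealSubfield L)) L (IsCMField.complexConj L)) 1) → E →L[ℂ] E))
      (_ : τ.toRepresentation.IsIrreducible)
      (_ : ∀ (g : ↥(UnitaryGroup.arch (↥(maximalRealSubfield L)) L (IsCMField.complexConj L) 3 ((StdForm.antidiagonal 3).over L) ⊓ unitaryGroupOfForm (conjMixed (↥(maximalRealSubfield L)) L (IsCMField.complexConj L)) 1)) (x y : E), ⟪τ g x, τ g y⟫_ℂ = ⟪x, y⟫_ℂ),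
      Schur.charProj μK τ ((((quasiSplit (↥(maximalRealSubfield L)) L (IsCMField.complexConj L) 3).rightRegular μ).restrict
        ((archToAdelic (↥(maximalRealSubfield L)) L (IsCMField.complexConj L) 3 ((StdForm.antidiagonal 3).over L)).comp
          (Subgroup.inclusion (inf_le_left : (UnitaryGroup.arch (↥(maximalRealSubfield L)) L (IsCMField.complexConj L) 3 ((StdForm.antidiagonal 3).over L) ⊓ unitaryGroupOfForm (conjMixed (↥(maximalRealSubfield L)) L (IsCMField.complexConj L)) 1) ≤
            UnitaryGroup.arch (↥(maximalRealSubfield L)) L (IsCMField.complexConj L) 3 ((StdForm.antidiagonal 3).over L)))))) f ∈ resGMidAtomGenτ L μ ξ μω U₀) :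
    resGMidBlock L μ ξ μω ≤ resGMidBlockτ L μ ξ μω :=
  hW1_of_regular L μ ξ μω μK hFIN
    (fun U₀ hU₀ => (hKwildLB U₀ hU₀).trans (Submodule.topologicalClosure_mono (Submodule.span_mono (locallyBounded_classes_subset_regular_classes L μ ξ hμω U₀))))
    hKreg

end Heads

end Summit.HodgeConjecture.HodgeConjecture.R90.S8

end
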